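import Summits.BirchSwinnertonDyer.BirchSwinnertonDyer.Theorems.ShaPrimaryTransferIsoRowDoorRank3
import Literature.NumberTheory.EllipticCurves.BSDSelmer
import Literature.NumberTheory.EllipticCurves.BSDRootNumberOddParityProofs
import HarnessLib

/-!
# BirchSwinnertonDyer — rank ≥ 2 observatory: rank-3 KERNEL-ISO census — THE SELMER GROUPS OF THE 966 ROWS, DETERMINED
# (`S^{(φ̂)}(E'/ℚ) = D₁`, `S^{(φ)}(E/ℚ) = D₂` as explicit finite sets; `#S·#S' = 32`; the rational points fill both;
# the Selmer-size histogram `112 · 398 · 364 · 92` as a kernel theorem) and THE 2-PARITY CROSS-CHECK at `p = 2`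

HONEST FRAMING: per-curve certified theorems and census instruments; no claim on BSD in rank ≥ 2.
Nothing here proves BSD, or finiteness of `Ш`, for any curve; nothing here bears on `ord_{s=1} L(E,s)`.

Setting: the rank-3 KERNEL-ISO table `rank3IsoRows` (`Rank2ObservatoryRank3IsoCensus`: the `966` curves of the rank-3
census `rank3Table` — Cremona, `N < 5·10⁵` — with exactly one rational point of order `2`, each a DATA record `R : IsoRow`
of a descent via `2`-isogeny for `E₁ = E_{a,b} : y² = x³ + a x² + b x`, `(a,b) = R.ab`, `E₂ = E_{−2a, a²−4b}`, with
claimed Selmer supersets `D₁ ⊇ S(a,b)`, `D₂ ⊇ S(−2a, a²−4b)`, exhibited class lists `cls₁`, `cls₂`, and the kernel check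
`IsoRow.check3`).  In the tree's dictionary (`Literature/…/TwoIsogenySelmerGroup.lean`, Silverman X.4.9 with Remark X.4.9.1):
`S(a,b) = twoIsogenySelmerGroup a b ≅ S^{(φ̂)}(E₂/ℚ) ⊇ α(E₁(ℚ))` (descent on the divisors of `b`) and
`S(−2a, a²−4b) = twoIsogenySelmerGroup' a b ≅ S^{(φ)}(E₁/ℚ) ⊇ ᾱ(E₂(ℚ))` (divisors of `a² − 4b`), `φ : E₁ → E₂`.

ALREADY IN THE TREE, INVOKED HERE BY NAME AND NOT RESTATED: `rank_ℤ E(ℚ) = 3` for all `966`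
(`rank3IsoRows_rank`), and the Ш side per row — `Ш(E/ℚ)[2] = 0`, `Ш(E/ℚ)[2^∞] = 0`, `t₂(E) = 0`,
`corank_{ℤ₂} Sel_{2^∞}(E/ℚ) = 3` on the census model (`IsoRow.door_of_check3`, `ShaPrimaryTransferIsoDoorsRank3.rank3IsoRows_doors`,
route ShaPrimaryTransfer's helper file `ShaPrimaryTransferIsoRowDoorRank3`, from the SHARPNESS `dim₂ S + dim₂ S' ≤ rank + 2`
of every checked row, `IsoRow.twoIsogenySelmerRank_add_le_of_checkRank`, and `XCubeAddDXSharpRankSha` §1).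

What THIS file adds (glue by name plus two kernel `decide`s over the table's own integer fields; no definitions, no
numerics, no new axioms):

* §1 (any `IsoRow`, rank `r`): `IsoRow.twoIsogenySelmerRank_add_eq_of_checkRank` — the descent of a checked row is
  EXACTLY sharp: `dim₂ S(a,b) + dim₂ S'(a,b) = r + 2`.  If moreover the claimed supersets are TIGHT,
  `#D₁ · #D₂ = 2^(r+2)` (a property of the record, decidable), then **the Selmer groups are determined**:
  `S(a,b) = D₁` and `S(−2a, a²−4b) = D₂` as `Finset ℤ` (`IsoRow.twoIsogenySelmerGroup_eq_of_checkRank`), with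
  `#S(a,b) = #D₁`, `#S'(a,b) = #D₂` (`IsoRow.card_twoIsogenySelmerGroup_eq_of_checkRank`), and **the rational points
  fill both Selmer groups**: `#α(E₁(ℚ)) = #D₁`, `#ᾱ(E₂(ℚ)) = #D₂` (`IsoRow.natCard_range_xSqClass_eq_of_checkRank`;
  Silverman X.4.7 with X.4.2(a): `S^{(φ̂)} = α(E₁(ℚ))`, `S^{(φ)} = ᾱ(E₂(ℚ))`, both `φ`-parts of `Ш` vanish).
* §2 (the `966`): ONE kernel `decide` certifies tightness and `|clsᵢ| = #Dᵢ` for every row (`rank3IsoRows_tight`), ONE the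
  counts of rows by `#D₁ ∈ {2, 4, 8, 16}` (`rank3IsoRows_sizes_count`).  Hence, for EVERY one of the `966` curves:
  `S(a,b) = D₁`, `S(−2a,a²−4b) = D₂`, `#S · #S' = 32 = 2^(3+2)`, `dim₂ S + dim₂ S' = 5`, and the exhibited classes are
  ALL the classes: `#α(E₁(ℚ)) = |cls₁|`, `#ᾱ(E₂(ℚ)) = |cls₂|` (`rank3IsoRows_selmerGroups`); and the SELMER-SIZE
  HISTOGRAM of the rank-3 KERNEL-ISO census is a theorem ABOUT SELMER GROUPS, not about data fields:
  `(#S^{(φ̂)}(E₂/ℚ), #S^{(φ)}(E₁/ℚ)) = (2,16)` for `112` curves, `(4,8)` for `398`, `(8,4)` for `364`, `(16,2)` for `92`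
  (`rank3IsoRows_selmer_histogram`; `112 + 398 + 364 + 92 = 966`).  (The docstring of `Rank2ObservatoryRank3IsoCensus`
  quotes the same four counts as prose, pairing side 1 with side 2.)
* §3 THE 2-PARITY CROSS-CHECK.  Hypothesis-free, per checked row: since `corank_{ℤ₂} Sel_{2^∞}(E/ℚ) = 3` is a kernel
  theorem, the `2`-parity statement `p_parity E 2` (`(−1)^{corank Sel_{2^∞}} = w(E)`, Dokchitser–Dokchitser 2010 Thm. 1.4,
  a NAMED FACT in the tree) is, for these curves, LITERALLY the statement `w(E) = −1` (`IsoRow.p_parity_two_iff_of_check3`).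
  Along the census JOIN (`aKey₃ r ∈ rank3IsoRows.map IsoRow.aKey`), granting only the named local-root-number facts `hKD`, `hR`
  that give `w(E) = −1` in the kernel (`Rank3Row.rootNumber_eq_neg_one_of_mem`), the conclusion of the `2`-parity theorem
  and the tree's analytic form `selmerCorank_mod_two_eq E 2` (`corank Sel_{2^∞} ≡ ord_{s=1} L (mod 2)`, both sides odd)
  HOLD for these `966` curves WITHOUT invoking Dokchitser–Dokchitser (`Rank3Row.p_parity_two_of_aKey_mem`): the Selmer
  certificates and the local root-number tables, two independent kernel computations, agree on all `966` rows.
  The census-row form of the door itself is recorded by name (`Rank3Row.door_two_of_aKey_mem`).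

NOT claimed: anything about `Ш(E/ℚ)[p^∞]` for odd `p`, the order of `Ш`, `#Ш_an`, or `ord_{s=1} L(E,s)`; the `8 521`
rank-3 census curves without a rational `2`-torsion point are out of reach of this frame.  Inputs: none in §§1–2 and in
`IsoRow.p_parity_two_iff_of_check3`; `hKD` [Kellock–Dokchitser 2023, Thm. 2.3 and §5] / `hR` [Rohrlich; Rizzo 2003 Table II]
in `Rank3Row.p_parity_two_of_aKey_mem` only.  Sorry-free; axioms `propext`, `Classical.choice`, `Quot.sound` only.

References: J. H. Silverman, *The Arithmetic of Elliptic Curves*, 2nd ed. (2009), Thm. X.4.2(a), Prop. X.4.7, Prop. X.4.9 and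
Remark X.4.9.1, proof of Prop. X.6.2(c); J. H. Silverman, J. Tate, *Rational Points on Elliptic Curves*, 2nd ed. (2015), §3.6
(`2^r = #α(Γ)·#ᾱ(Γ̄)/4`); J. E. Cremona, *Algorithms for Modular Elliptic Curves*, 2nd ed. (1997), §3.6 (Method 1) and
Table 1; T. Dokchitser, V. Dokchitser, *On the Birch–Swinnerton-Dyer quotients modulo squares*, Ann. of Math. 172 (2010),
Thm. 1.4; R. Greenberg, *Iwasawa theory for elliptic curves*, LNM 1716 (1999), §1.
-/

-- single-conjunct summit: `Summit.BirchSwinnertonDyer.BirchSwinnertonDyer.…` repeats the name by design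
set_option linter.dupNamespace false
set_option autoImplicit false

noncomputable section

open scoped Classical

namespace Summit.BirchSwinnertonDyer.BirchSwinnertonDyer.Rank2Observatory

open WeierstrassCurve Literature Literature.NumberTheory.EllipticCurves
open Literature.Barriers.BirchSwinnertonDyer.DokchitserDokchitser2011 RootNumber
open IsoLocal

/-! ### §0 Arithmetic glue -/

/-- Two bounded factors with the maximal product are both maximal: `a ≤ A`, `b ≤ B`, `a·b = A·B > 0` give
`a = A` and `b = B`. [folklore] -/
private theorem eq_and_eq_of_le_of_le_of_mul_eq {a b A B : ℕ} (ha : a ≤ A) (hb : b ≤ B) (h : a * b = A * B)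
    (hpos : 0 < a * b) : a = A ∧ b = B := by
  have ha0 : 0 < a := Nat.pos_of_mul_pos_right hpos |> fun _ => Nat.pos_of_ne_zero fun h0 => by
    rw [h0, zero_mul] at hpos; exact lt_irrefl 0 hpos
  have hb0 : 0 < b := Nat.pos_of_ne_zero fun h0 => by rw [h0, mul_zero] at hpos; exact lt_irrefl 0 hpos
  have hA0 : 0 < A := lt_of_lt_of_le ha0 ha
  have h1 : a * b ≤ A * b := Nat.mul_le_mul_right b ha
  have h2 : A * b ≤ A * B := Nat.mul_le_mul_left A hb
  have hab' : a * b = A * b := le_antisymm h1 (h ▸ h2)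
  have hA : a = A := Nat.eq_of_mul_eq_mul_right hb0 hab'
  have hB' : A * b = A * B := hab'.symm.trans h
  exact ⟨hA, Nat.eq_of_mul_eq_mul_left hA0 hB'⟩

namespace IsoLocal.IsoRow

/-! ### §1 A checked row in rank `r`: the descent is exactly sharp; tight supersets ARE the Selmer groups -/

/-- **Exact sharpness of a checked row**: `R.checkRank r = true ⇒ dim₂ S(a,b) + dim₂ S'(a,b) = r + 2`
(`≤` is `twoIsogenySelmerRank_add_le_of_checkRank`; `≥` is Silverman–Tate's `2^{rank+2} ∣ #S·#S'`, tree
`natCard_sha_inf_range_eq_one_of_selmerRank_add_le`, with `rank E_{a,b}(ℚ) = r` transported from the census model).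
[cite: SilvermanAEC2009, Prop. X.4.7 and Thm. X.4.2(a)] [cite: SilvermanTate2015, §3.6] -/
theorem twoIsogenySelmerRank_add_eq_of_checkRank (R : IsoRow) {r : ℕ} (h : R.checkRank r = true) :
    twoIsogenySelmerRank R.ab.1 R.ab.2 + twoIsogenySelmerRank' R.ab.1 R.ab.2 = r + 2 := by
  obtain ⟨hsc, he, hab, -⟩ := checkRank_parts R h
  haveI := isElliptic_halfModel hab
  haveI := isElliptic_mk_of_ne_zero (F := ℚ) hab
  obtain ⟨-, -, hsum⟩ := natCard_sha_inf_range_eq_one_of_selmerRank_add_le hab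
    (twoIsogenySelmerRank_add_le_of_checkRank R h)
  have hr : (⟨0, (R.ab.1 : ℚ), 0, (R.ab.2 : ℚ), 0⟩ : WeierstrassCurve ℚ).mordellWeilRank = r := by
    obtain ⟨C, hC⟩ := exists_transport R hsc he
    have ht := mordellWeilRank_variableChange_holds R.curve C
    rw [mordellWeilRank_variableChange, hC] at ht
    rw [ht]
    exact mordellWeilRank_eq_of_checkRank R h
  omega

/-- **Tight supersets have the Selmer cardinalities**: `R.checkRank r = true` and `#D₁ · #D₂ = 2^(r+2)` give
`#S(a,b) = #D₁` and `#S(−2a, a²−4b) = #D₂` (`S ⊆ D₁`, `S' ⊆ D₂`, `#S · #S' = 2^{dim₂ S + dim₂ S'} = 2^(r+2) = #D₁ · #D₂`).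
[cite: SilvermanAEC2009, Prop. X.4.9 and Prop. X.4.7] [cite: SilvermanTate2015, §3.6] -/
theorem card_twoIsogenySelmerGroup_eq_of_checkRank (R : IsoRow) {r : ℕ} (h : R.checkRank r = true)
    (ht : R.s₁.D.dedup.length * R.s₂.D.dedup.length = 2 ^ (r + 2)) :
    (twoIsogenySelmerGroup R.ab.1 R.ab.2).card = R.s₁.D.dedup.length ∧
      (twoIsogenySelmerGroup (-2 * R.ab.1) (R.ab.1 ^ 2 - 4 * R.ab.2)).card = R.s₂.D.dedup.length := by
  obtain ⟨-, -, hab, hD₁, hD₂, -⟩ := checkRank_parts R h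
  have hsum := twoIsogenySelmerRank_add_eq_of_checkRank R h
  have e₁ : 2 ^ twoIsogenySelmerRank R.ab.1 R.ab.2 = (twoIsogenySelmerGroup R.ab.1 R.ab.2).card :=
    two_pow_twoIsogenySelmerRank_eq_card hab
  have e₂ : 2 ^ twoIsogenySelmerRank' R.ab.1 R.ab.2 =
      (twoIsogenySelmerGroup (-2 * R.ab.1) (R.ab.1 ^ 2 - 4 * R.ab.2)).card :=
    two_pow_twoIsogenySelmerRank'_eq_card hab
  have l₁ : (twoIsogenySelmerGroup R.ab.1 R.ab.2).card ≤ R.s₁.D.dedup.length := by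
    rw [← List.card_toFinset]; exact Finset.card_le_card hD₁
  have l₂ : (twoIsogenySelmerGroup (-2 * R.ab.1) (R.ab.1 ^ 2 - 4 * R.ab.2)).card ≤ R.s₂.D.dedup.length := by
    rw [← List.card_toFinset]; exact Finset.card_le_card hD₂
  have hprod : (twoIsogenySelmerGroup R.ab.1 R.ab.2).card *
      (twoIsogenySelmerGroup (-2 * R.ab.1) (R.ab.1 ^ 2 - 4 * R.ab.2)).card = 2 ^ (r + 2) := by
    rw [← e₁, ← e₂, ← pow_add, hsum]
  exact eq_and_eq_of_le_of_le_of_mul_eq l₁ l₂ (hprod.trans ht.symm) (by rw [hprod]; positivity)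

/-- **THE SELMER GROUPS OF A TIGHT CHECKED ROW ARE DETERMINED**: `S(a,b) = D₁` and `S(−2a, a²−4b) = D₂` as finite sets of
(squarefree) integers — in Silverman's notation `S^{(φ̂)}(E₂/ℚ) = D₁` and `S^{(φ)}(E₁/ℚ) = D₂` read in `ℚ*/ℚ*²`.
[cite: SilvermanAEC2009, Prop. X.4.9 and Remark X.4.9.1] [cite: CremonaAlgorithms1997, §3.6 (Method 1)] -/
theorem twoIsogenySelmerGroup_eq_of_checkRank (R : IsoRow) {r : ℕ} (h : R.checkRank r = true)
    (ht : R.s₁.D.dedup.length * R.s₂.D.dedup.length = 2 ^ (r + 2)) :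
    twoIsogenySelmerGroup R.ab.1 R.ab.2 = R.s₁.D.toFinset ∧
      twoIsogenySelmerGroup (-2 * R.ab.1) (R.ab.1 ^ 2 - 4 * R.ab.2) = R.s₂.D.toFinset := by
  obtain ⟨-, -, -, hD₁, hD₂, -⟩ := checkRank_parts R h
  obtain ⟨c₁, c₂⟩ := card_twoIsogenySelmerGroup_eq_of_checkRank R h ht
  exact ⟨Finset.eq_of_subset_of_card_le hD₁ (by rw [List.card_toFinset, c₁]),
    Finset.eq_of_subset_of_card_le hD₂ (by rw [List.card_toFinset, c₂])⟩

/-- **THE RATIONAL POINTS FILL BOTH SELMER GROUPS** of a tight checked row: `#α(E₁(ℚ)) = #D₁ (= #S(a,b))` and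
`#ᾱ(E₂(ℚ)) = #D₂ (= #S'(a,b))` — `S^{(φ̂)}(E₂/ℚ) = α(E₁(ℚ))` and `S^{(φ)}(E₁/ℚ) = ᾱ(E₂(ℚ))` in number, both `φ`-parts of `Ш`
being trivial (tree `natCard_range_xSqClass_eq_of_selmerRank_add_le`). [cite: SilvermanAEC2009, Prop. X.4.7 and Thm. X.4.2(a)]
[cite: SilvermanTate2015, §3.6] -/
theorem natCard_range_xSqClass_eq_of_checkRank (R : IsoRow) {r : ℕ} (h : R.checkRank r = true)
    (ht : R.s₁.D.dedup.length * R.s₂.D.dedup.length = 2 ^ (r + 2)) :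
    Nat.card (Set.range (⟨0, (R.ab.1 : ℚ), 0, (R.ab.2 : ℚ), 0⟩ : WeierstrassCurve ℚ).xSqClass) = R.s₁.D.dedup.length ∧
      Nat.card (Set.range (⟨0, ((-2 * R.ab.1 : ℤ) : ℚ), 0, ((R.ab.1 ^ 2 - 4 * R.ab.2 : ℤ) : ℚ), 0⟩ :
        WeierstrassCurve ℚ).xSqClass) = R.s₂.D.dedup.length := by
  obtain ⟨-, -, hab, -⟩ := checkRank_parts R h
  haveI := isElliptic_halfModel hab
  haveI := isElliptic_mk_of_ne_zero (F := ℚ) hab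
  obtain ⟨h₁, h₂⟩ := natCard_range_xSqClass_eq_of_selmerRank_add_le hab (twoIsogenySelmerRank_add_le_of_checkRank R h)
  obtain ⟨c₁, c₂⟩ := card_twoIsogenySelmerGroup_eq_of_checkRank R h ht
  have e₁ : 2 ^ twoIsogenySelmerRank R.ab.1 R.ab.2 = (twoIsogenySelmerGroup R.ab.1 R.ab.2).card :=
    two_pow_twoIsogenySelmerRank_eq_card hab
  have e₂ : 2 ^ twoIsogenySelmerRank' R.ab.1 R.ab.2 =
      (twoIsogenySelmerGroup (-2 * R.ab.1) (R.ab.1 ^ 2 - 4 * R.ab.2)).card :=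
    two_pow_twoIsogenySelmerRank'_eq_card hab
  exact ⟨h₁.trans (e₁.trans c₁), h₂.trans (e₂.trans c₂)⟩

/-! ### §1b The `2`-parity statement of a checked rank-3 row IS `w(E) = −1` (hypothesis-free) -/

/-- **`2`-parity ⇔ sign, for a `check3` row.** On the census model `E = R.curve` of a row passing `IsoRow.check3`,
`corank_{ℤ₂} Sel_{2^∞}(E/ℚ) = 3` is a kernel theorem (`IsoRow.door_of_check3`, route ShaPrimaryTransfer), so the
`2`-parity statement `p_parity E 2 : (−1)^{corank Sel_{2^∞}(E/ℚ)} = w(E)` (Dokchitser–Dokchitser's theorem, a named fact in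
the tree — NOT used) is EQUIVALENT to `w(E) = −1`. [cite: DokchitserDokchitserAnnals2010, Thm. 1.4] [cite: Greenberg1999LNM, §1 (pp. 54–57)] -/
theorem p_parity_two_iff_of_check3 (R : IsoRow) (h : R.check3 = true) :
    haveI := isElliptic_curve_of_checkRank R h
    p_parity R.curve 2 ↔ R.curve.rootNumber = -1 := by
  haveI := isElliptic_curve_of_checkRank R h
  have hs : R.curve.selmerCorank 2 = 3 := (door_of_check3 R h).2.2.2.2
  show (-1 : ℤ) ^ R.curve.selmerCorank 2 = R.curve.rootNumber ↔ R.curve.rootNumber = -1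
  rw [hs]
  norm_num
  exact eq_comm

end IsoLocal.IsoRow

/-! ### §2 The 966 rank-3 KERNEL-ISO rows: tightness (one kernel `decide`), the Selmer groups, the histogram -/

/-- **Tightness of the 966 records** (kernel `decide` over the table's integer fields only): for every row,
`#D₁ · #D₂ = 32` and the exhibited class lists have exactly `#D₁`, `#D₂` entries. [cite: CremonaAlgorithms1997, Tables] -/
theorem rank3IsoRows_tight : rank3IsoRows.all (fun R =>
    R.s₁.D.dedup.length * R.s₂.D.dedup.length == 32 &&
      (R.s₁.cls.length == R.s₁.D.dedup.length && R.s₂.cls.length == R.s₂.D.dedup.length)) = true := by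
  decide +kernel

/-- Row-wise form of `rank3IsoRows_tight`. [cite: CremonaAlgorithms1997, Tables] -/
theorem rank3IsoRows_tight_mem {R : IsoRow} (hR : R ∈ rank3IsoRows) :
    R.s₁.D.dedup.length * R.s₂.D.dedup.length = 2 ^ (3 + 2) ∧
      R.s₁.cls.length = R.s₁.D.dedup.length ∧ R.s₂.cls.length = R.s₂.D.dedup.length := by
  have h := List.all_eq_true.mp rank3IsoRows_tight R hR
  simp only [Bool.and_eq_true, beq_iff_eq] at h
  exact ⟨h.1, h.2.1, h.2.2⟩

/-- **The data histogram** (kernel `decide`): `112`, `398`, `364`, `92` of the `966` rows have `#D₁ = 2, 4, 8, 16`.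
[cite: CremonaAlgorithms1997, Tables] -/
theorem rank3IsoRows_sizes_count :
    (rank3IsoRows.filter fun R => R.s₁.D.dedup.length == 2).length = 112 ∧
      (rank3IsoRows.filter fun R => R.s₁.D.dedup.length == 4).length = 398 ∧
      (rank3IsoRows.filter fun R => R.s₁.D.dedup.length == 8).length = 364 ∧
      (rank3IsoRows.filter fun R => R.s₁.D.dedup.length == 16).length = 92 := by
  refine ⟨?_, ?_, ?_, ?_⟩ <;> decide +kernel

/-- **THE SELMER GROUPS OF ALL 966 RANK-3 KERNEL-ISO CURVES, DETERMINED.** For every row `R` of `rank3IsoRows`, with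
`(a,b) = R.ab`, `E₁ = E_{a,b}`, `E₂ = E_{−2a, a²−4b}`: `S(a,b) = D₁` and `S(−2a, a²−4b) = D₂` EXACTLY (as `Finset ℤ`),
`#S(a,b) · #S'(a,b) = 32 = 2^(3+2)`, `dim₂ S + dim₂ S' = 5`, and the classes exhibited in the certificate are ALL the classes:
`#α(E₁(ℚ)) = |cls₁| = #D₁`, `#ᾱ(E₂(ℚ)) = |cls₂| = #D₂` — unconditionally. [cite: SilvermanAEC2009, Prop. X.4.9, Prop. X.4.7 and Thm. X.4.2(a)]
[cite: SilvermanTate2015, §3.6] [cite: CremonaAlgorithms1997, §3.6 (Method 1)] -/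
theorem rank3IsoRows_selmerGroups : ∀ R ∈ rank3IsoRows,
    twoIsogenySelmerGroup R.ab.1 R.ab.2 = R.s₁.D.toFinset ∧
      twoIsogenySelmerGroup (-2 * R.ab.1) (R.ab.1 ^ 2 - 4 * R.ab.2) = R.s₂.D.toFinset ∧
      (twoIsogenySelmerGroup R.ab.1 R.ab.2).card *
          (twoIsogenySelmerGroup (-2 * R.ab.1) (R.ab.1 ^ 2 - 4 * R.ab.2)).card = 32 ∧
      twoIsogenySelmerRank R.ab.1 R.ab.2 + twoIsogenySelmerRank' R.ab.1 R.ab.2 = 5 ∧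
      Nat.card (Set.range (⟨0, (R.ab.1 : ℚ), 0, (R.ab.2 : ℚ), 0⟩ : WeierstrassCurve ℚ).xSqClass) = R.s₁.cls.length ∧
      Nat.card (Set.range (⟨0, ((-2 * R.ab.1 : ℤ) : ℚ), 0, ((R.ab.1 ^ 2 - 4 * R.ab.2 : ℤ) : ℚ), 0⟩ :
        WeierstrassCurve ℚ).xSqClass) = R.s₂.cls.length := by
  intro R hR
  have h : R.checkRank 3 = true := List.all_eq_true.mp rank3IsoRows_check R hR
  obtain ⟨ht, hc₁, hc₂⟩ := rank3IsoRows_tight_mem hR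
  obtain ⟨s₁, s₂⟩ := IsoRow.twoIsogenySelmerGroup_eq_of_checkRank R h ht
  obtain ⟨c₁, c₂⟩ := IsoRow.card_twoIsogenySelmerGroup_eq_of_checkRank R h ht
  obtain ⟨n₁, n₂⟩ := IsoRow.natCard_range_xSqClass_eq_of_checkRank R h ht
  refine ⟨s₁, s₂, ?_, IsoRow.twoIsogenySelmerRank_add_eq_of_checkRank R h, ?_, ?_⟩
  · rw [c₁, c₂, ht]; norm_num
  · rw [n₁, hc₁]
  · rw [n₂, hc₂]

/-- **THE SELMER-SIZE HISTOGRAM OF THE RANK-3 KERNEL-ISO CENSUS, as a theorem about Selmer groups**: among the `966` curves,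
`#S(a,b) = #S^{(φ̂)}(E₂/ℚ)` equals `2` for `112`, `4` for `398`, `8` for `364`, `16` for `92` (and `#S^{(φ)}(E₁/ℚ) = 32/#S^{(φ̂)}(E₂/ℚ)`
= `16, 8, 4, 2` respectively, by `rank3IsoRows_selmerGroups`). [cite: SilvermanAEC2009, Prop. X.4.9] [cite: CremonaAlgorithms1997, Tables] -/
theorem rank3IsoRows_selmer_histogram :
    (rank3IsoRows.filter fun R => (twoIsogenySelmerGroup R.ab.1 R.ab.2).card == 2).length = 112 ∧
      (rank3IsoRows.filter fun R => (twoIsogenySelmerGroup R.ab.1 R.ab.2).card == 4).length = 398 ∧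
      (rank3IsoRows.filter fun R => (twoIsogenySelmerGroup R.ab.1 R.ab.2).card == 8).length = 364 ∧
      (rank3IsoRows.filter fun R => (twoIsogenySelmerGroup R.ab.1 R.ab.2).card == 16).length = 92 := by
  have key : ∀ k : ℕ, (rank3IsoRows.filter fun R => (twoIsogenySelmerGroup R.ab.1 R.ab.2).card == k) =
      rank3IsoRows.filter fun R => R.s₁.D.dedup.length == k := fun k =>
    List.filter_congr fun R hR => by
      have h : R.checkRank 3 = true := List.all_eq_true.mp rank3IsoRows_check R hR
      simp only [(IsoRow.card_twoIsogenySelmerGroup_eq_of_checkRank R h (rank3IsoRows_tight_mem hR).1).1]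
  rw [key 2, key 4, key 8, key 16]
  exact rank3IsoRows_sizes_count

/-- The four histogram classes exhaust the table: `112 + 398 + 364 + 92 = 966 = |rank3IsoRows|`. [cite: CremonaAlgorithms1997, Tables] -/
theorem rank3IsoRows_histogram_total : 112 + 398 + 364 + 92 = rank3IsoRows.length := by
  rw [rank3IsoRows_length]

/-- `#S(a,b) · #S'(a,b) = 32` and `dim₂ S + dim₂ S' = 5` alone, for every one of the `966` curves — the prose
«all of them have the sharp bound `#S^(φ)·#S^(φ̂) = 2⁵`» of `Rank2ObservatoryRank3IsoCensus` as a kernel theorem.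
[cite: SilvermanAEC2009, Prop. X.4.7 and Thm. X.4.2(a)] -/
theorem rank3IsoRows_card_selmer_mul : ∀ R ∈ rank3IsoRows,
    (twoIsogenySelmerGroup R.ab.1 R.ab.2).card * (twoIsogenySelmerGroup' R.ab.1 R.ab.2).card = 32 ∧
      twoIsogenySelmerRank R.ab.1 R.ab.2 + twoIsogenySelmerRank' R.ab.1 R.ab.2 = 5 :=
  fun R hR => ⟨(rank3IsoRows_selmerGroups R hR).2.2.1, (rank3IsoRows_selmerGroups R hR).2.2.2.1⟩

/-! ### §3 Along the census JOIN: the door at `2` by name, and the `2`-parity cross-check -/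

/-- **Census-row form of the door at `2`** (route ShaPrimaryTransfer's `rank3IsoRows_doors`, INVOKED, not reproved): a
rank-3 census row whose model occurs in the KERNEL-ISO table has, on its census model `E = r.curve`, `rank_ℤ E(ℚ) = 3`,
`Ш(E/ℚ)[2] = 0`, `Ш(E/ℚ)[2^∞] = 0`, `t₂(E) = 0`, `corank_{ℤ₂} Sel_{2^∞}(E/ℚ) = 3` — unconditionally.
[cite: SilvermanAEC2009, Prop. X.4.7 and Thm. X.4.2(a)] [cite: Greenberg1999LNM, §1 (pp. 54–57)] -/
theorem Rank3Row.door_two_of_aKey_mem {r : Rank3Row} (h : aKey₃ r ∈ rank3IsoRows.map IsoRow.aKey) :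
    ∃ _h : r.curve.IsElliptic, r.curve.mordellWeilRank = 3 ∧ (∀ c ∈ r.curve.sha, 2 • c = 0 → c = 0) ∧
      AddCommGroup.primaryComponent r.curve.sha 2 = ⊥ ∧ r.curve.shaCorank 2 = 0 ∧ r.curve.selmerCorank 2 = 3 := by
  obtain ⟨R, hR, hk⟩ := List.mem_map.mp h
  rw [curve_eq_of_aKey_eq hk]
  exact Theorems.ShaPrimaryTransferIsoDoorsRank3.rank3IsoRows_doors R hR

/-- **Census-row form of the Selmer groups**: for a rank-3 census row whose model occurs in the KERNEL-ISO table there is a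
table row `R` with the same model whose record DETERMINES both Selmer groups of the row's descent model:
`S(a,b) = D₁`, `S(−2a,a²−4b) = D₂`, `#S·#S' = 32`. [cite: SilvermanAEC2009, Prop. X.4.9] [cite: CremonaAlgorithms1997, Tables] -/
theorem Rank3Row.selmerGroups_of_aKey_mem {r : Rank3Row} (h : aKey₃ r ∈ rank3IsoRows.map IsoRow.aKey) :
    ∃ R ∈ rank3IsoRows, r.curve = R.curve ∧
      twoIsogenySelmerGroup R.ab.1 R.ab.2 = R.s₁.D.toFinset ∧
      twoIsogenySelmerGroup (-2 * R.ab.1) (R.ab.1 ^ 2 - 4 * R.ab.2) = R.s₂.D.toFinset ∧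
      (twoIsogenySelmerGroup R.ab.1 R.ab.2).card *
          (twoIsogenySelmerGroup (-2 * R.ab.1) (R.ab.1 ^ 2 - 4 * R.ab.2)).card = 32 := by
  obtain ⟨R, hR, hk⟩ := List.mem_map.mp h
  obtain ⟨s₁, s₂, hm, -⟩ := rank3IsoRows_selmerGroups R hR
  exact ⟨R, hR, curve_eq_of_aKey_eq hk, s₁, s₂, hm⟩

/-- **THE `2`-PARITY CROSS-CHECK along the JOIN.** For a row of `rank3Table` whose model occurs in the KERNEL-ISO table,
granting ONLY the named local-root-number facts `hKD`, `hR` (which give `w(E) = −1` in the kernel,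
`Rank3Row.rootNumber_eq_neg_one_of_mem`): the conclusion of the `2`-parity theorem `p_parity E 2` and the tree's analytic form
`selmerCorank_mod_two_eq E 2` (`corank Sel_{2^∞} ≡ ord_{s=1} L (mod 2)`: both sides odd, `ord` odd for sign `−1` by
`odd_analyticRank_of_rootNumber_eq_neg_one`) HOLD — Dokchitser–Dokchitser's theorem is NOT invoked: two independent kernel
computations (the `2`-isogeny Selmer certificates, the local root-number tables) agree.
[cite: DokchitserDokchitserAnnals2010, Thm. 1.4] [cite: KellockDokchitser2023, Thm. 2.3 and §5] [cite: SilvermanAEC2009, C.16 Thm. 16.3] -/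
theorem Rank3Row.p_parity_two_of_aKey_mem {r : Rank3Row} (hr : r ∈ rank3Table)
    (h : aKey₃ r ∈ rank3IsoRows.map IsoRow.aKey)
    (hKD : r.curve.rootNumber_eq_neg_finprod_tableLocalRootNumberAt')
    (hR : r.curve.rootNumber_eq_neg_finprod_fullTableLocalRootNumberAt) :
    ∃ _h : r.curve.IsElliptic, r.curve.rootNumber = -1 ∧ r.curve.selmerCorank 2 = 3 ∧
      p_parity r.curve 2 ∧ selmerCorank_mod_two_eq r.curve 2 ∧ Odd r.curve.analyticRank := by
  have hw : r.curve.rootNumber = -1 := Rank3Row.rootNumber_eq_neg_one_of_mem hr hKD hR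
  obtain ⟨hE, -, -, -, -, hs⟩ := Rank3Row.door_two_of_aKey_mem h
  have ho : Odd r.curve.analyticRank := odd_analyticRank_of_rootNumber_eq_neg_one hw
  refine ⟨hE, hw, hs, ?_, ?_, ho⟩
  · show (-1 : ℤ) ^ r.curve.selmerCorank 2 = r.curve.rootNumber
    rw [hs, hw]; norm_num
  · show r.curve.selmerCorank 2 % 2 = r.curve.analyticRank % 2
    obtain ⟨k, hk⟩ := ho
    rw [hs, hk]; omega

/-- **Table form of the cross-check, hypothesis-free half**: for EVERY one of the `966` rows, `p_parity E 2 ↔ w(E) = −1` on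
the census model, and the model IS a census curve. [cite: DokchitserDokchitserAnnals2010, Thm. 1.4] [cite: CremonaAlgorithms1997, Tables] -/
theorem rank3IsoRows_p_parity_two_iff : ∀ R ∈ rank3IsoRows, (∃ r ∈ rank3Table, r.curve = R.curve) ∧
    ∃ _h : R.curve.IsElliptic, R.curve.selmerCorank 2 = 3 ∧ (p_parity R.curve 2 ↔ R.curve.rootNumber = -1) := by
  intro R hR
  have h : R.check3 = true := List.all_eq_true.mp rank3IsoRows_check R hR
  exact ⟨rank3IsoRows_census R hR, IsoRow.isElliptic_curve_of_checkRank R h, (IsoRow.door_of_check3 R h).2.2.2.2,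
    IsoRow.p_parity_two_iff_of_check3 R h⟩

end Summit.BirchSwinnertonDyer.BirchSwinnertonDyer.Rank2Observatory

end
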